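import Mathlib.GroupTheory.Index
import Mathlib.Algebra.Group.Subgroup.Finite
import Mathlib.Data.ZMod.QuotientGroup
import Mathlib.Tactic.Linarith
import Mathlib.Tactic.Ring
import HarnessLib

/-!
# Jetchev 2008 §5.2 ∕ §6.3 — the LOZENGE AT ONE KOLYVAGIN PRIME as pure finite-group algebra:
# the two one-step inequalities behind the existence of core vertices (cell `bsd-stepL`, seat
# `bsd-stepL-tam3-p1`, helper toward item 19109 `EulerHalvesAtThree`, stub `stub_jetchevMaxHLAtThree`)

HONEST FRAMING. Theorems of elementary group theory only; nothing here proves BSD, J₃, or any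
divisibility of a Heegner point; no item closes; 0 classes move (T7). `--supports
stmt-BirchSwinnertonDyer-19109` (helper). WHY THIS FILE: item 19109's registered stub
`stub_jetchevMaxHLAtThree` (skeleton v4) is D. Jetchev, *Global divisibility of Heegner points and
Tamagawa numbers*, Compos. Math. **144** (2008) 811–826 [held: `paper:arxiv-math_0703431`], Thm. 1.4
(`m_∞ ≥ ord_p c_q`) READ at `p = 3 ∥ N`; its kernel discharge is the line S1–S10 of the `bsd-jet` sheet
`PV2-J6-KERNEL.md` over the abstract §6 theorems of `Theorems/Rank1ResidualJetSection6.lean`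
(p471669: Thm. 6.3 and the proof of Thm. 1.4, with Prop. 6.4 «core vertices exist» as the HYPOTHESIS
`h64`, there graded «FACT, M — finite abelian p-group invariant theory, days»). This file and its
sequel `…EulerHalvesAtThreeCoreVertex.lean` turn Prop. 6.4 into a KERNEL THEOREM over the same kind
of abstract data, by an argument that is NOT the printed one: the printed proof (p. 824) lowers the
invariants `(m, x₁, x₂, …)`, `(y₁, y₂, …)` of `𝓗_{𝓕(c)}^{±}` one at a time and uses «`y₁ = y₂`» (the
Cassels–Tate ∕ Flach pair structure of the non-free part, Howard 2004 ∕ Mazur–Rubin 2004 §4, not in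
the tree); but the inequality of Thm. 6.3 uses of a core vertex ONLY `𝓗_{𝓕(c)}^{−ε(c)} = 0` (p471669's
`hcore : A' = ⊥`; its `ε`-side data are `κ̃` of order `p^m` and nothing else), and such HALF-core
vertices are reached by a POTENTIAL argument needing per step only the two inequalities proved
here.

## What is proved (one prime `ℓ ∤ c`, one sign `s`, level `p^m`; dictionary [J] §§4.3, 5.2)
`loc ↦ loc_λ : H¹(K, E[p^m])^s → H¹(K_λ, E[p^m])^s`; `Rel ↦ 𝓗_{𝓕^ℓ(c)}^s` (no condition at `λ`;
FINITE); `Hf ↦ H¹_f(K_λ)^s`, `Htr ↦ H¹_tr(K_λ)^s` with `Hf ⊓ Htr = 0`; so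
`Rel ⊓ loc⁻¹(Hf) = 𝓗_{𝓕(c)}^s`, `Rel ⊓ loc⁻¹(Htr) = 𝓗_{𝓕(cℓ)}^s`, `Rel ⊓ ker loc = 𝓗_{𝓕_ℓ(c)}^s`; the
one global-duality input is the NUMBER `#loc(Rel)` (= `p^m` by Thm. 5.1 for `𝓕_ℓ(c) ≼ 𝓕^ℓ(c)` and the
self-duality of the Kummer structure — Lemma 5.2 (iii) `a + a^* = m`; supplied by the caller).
* `lozenge_epsSide`: if some `x ∈ 𝓗_{𝓕(c)}^s` has `ord loc_λ x ≥ #loc(Rel)` then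
  `𝓗_{𝓕(c)}^s = 𝓗_{𝓕^ℓ(c)}^s`, `𝓗_{𝓕(cℓ)}^s = 𝓗_{𝓕_ℓ(c)}^s` and `#𝓗_{𝓕(c)}^s = #𝓗_{𝓕_ℓ(c)}^s · ord loc_λ x`
  (lozenge lengths `a = d = 0`, `c = m`).
* `lozenge_negSide`: for any `y ∈ 𝓗_{𝓕(c)}^s`,
  `#𝓗_{𝓕(cℓ)}^s · (ord loc_λ y)² ≤ #loc(Rel) · #𝓗_{𝓕(c)}^s` (from `c + d ≤ #loc(Rel)`: the images of
  `𝓗_{𝓕(c)}` and `𝓗_{𝓕(cℓ)}` at `λ` sit in the disjoint `H¹_f`, `H¹_tr`).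
* §1: the counting lemmas `#H·[K:H] = #K`, `#S = #(S ⊓ ker f)·#f(S)`, `#f(A)·#f(B) ≤ #f(C)` for
  `A, B ≤ C` mapping into disjoint subgroups, finiteness of images ∕ subgroups.
NOT here: any Galois cohomology, any Selmer structure, the sign split of Thm. 5.1 (bsd-jet pv-1's
`Rank1ResidualJetGlobalDuality*.lean` is its both-signs counting form). References (locators only; no
cited FACT is declared): [cite: Jetchev2008, §4.3, Thm. 5.1, Lemma 5.2 (pp. 819–822), Prop. 6.4 (p. 824)].
Design: no definitions; `Type*`-polymorphic; `Nat.card`, `AddSubgroup.relIndex`; namespace shared with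
p471669 (`…Rank1Residual.JET.Section6`) so that the (J∥) ∕ JetchevMaxHL instantiation finds all §6
bricks in one place. Axioms: `propext`, `Classical.choice`, `Quot.sound`.
-/

set_option autoImplicit false

noncomputable section

open scoped Classical

namespace Summit.BirchSwinnertonDyer.Rank1Residual.JET.Section6


/-! ### §1 Finite-group counting lemmas -/

/-- For subgroups `H ≤ K`: `#H · [K : H] = #K` (`Nat.card`, `AddSubgroup.relIndex`). -/
theorem card_mul_relIndex_of_le {G : Type*} [AddCommGroup G] {H K : AddSubgroup G} (h : H ≤ K) :
    Nat.card H * H.relIndex K = Nat.card K := by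
  have := AddSubgroup.relIndex_mul_relIndex (⊥ : AddSubgroup G) H K bot_le h
  simpa [AddSubgroup.relIndex_bot_left] using this

/-- `#S = #(S ⊓ ker f) · #f(S)` for a subgroup `S` and a homomorphism `f`. -/
theorem card_eq_card_inf_ker_mul_card_map {G L : Type*} [AddCommGroup G] [AddCommGroup L]
    (f : G →+ L) (S : AddSubgroup G) :
    Nat.card S = Nat.card ↥(S ⊓ f.ker) * Nat.card (S.map f) := by
  have h1 : f.ker.relIndex S = Nat.card (S.map f) := AddSubgroup.relIndex_ker S f
  have h2 : (f.ker ⊓ S).relIndex S = f.ker.relIndex S := AddSubgroup.inf_relIndex_right f.ker S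
  have h3 : Nat.card ↥(f.ker ⊓ S) * (f.ker ⊓ S).relIndex S = Nat.card S :=
    card_mul_relIndex_of_le inf_le_right
  have h4 : S ⊓ f.ker = f.ker ⊓ S := inf_comm _ _
  rw [h4, ← h1, ← h2, h3]

/-- If `A, B ≤ C` map under `f` into two DISJOINT subgroups `P`, `Q` of the target, then
`#f(A) · #f(B) ≤ #f(C)` (the map `(u, v) ↦ u + v` from `f(A) × f(B)` to `f(C)` is injective). -/
theorem card_map_mul_card_map_le {G L : Type*} [AddCommGroup G] [AddCommGroup L]
    (f : G →+ L) {A B C : AddSubgroup G} (hA : A ≤ C) (hB : B ≤ C)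
    {P Q : AddSubgroup L} (hPQ : Disjoint P Q) (hAP : A.map f ≤ P) (hBQ : B.map f ≤ Q)
    [Finite (C.map f)] :
    Nat.card (A.map f) * Nat.card (B.map f) ≤ Nat.card (C.map f) := by
  rw [← Nat.card_prod]
  let g : (A.map f) × (B.map f) → C.map f := fun uv =>
    ⟨(uv.1 : L) + (uv.2 : L), by
      obtain ⟨a, ha, hau⟩ := AddSubgroup.mem_map.mp uv.1.2
      obtain ⟨b, hb, hbv⟩ := AddSubgroup.mem_map.mp uv.2.2
      exact AddSubgroup.mem_map.mpr ⟨a + b, C.add_mem (hA ha) (hB hb), by rw [map_add, hau, hbv]⟩⟩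
  refine Nat.card_le_card_of_injective g ?_
  rintro ⟨u, v⟩ ⟨u', v'⟩ h
  have h' : (u : L) + v = u' + v' := congrArg Subtype.val h
  have hd : (u : L) - u' = v' - v := by
    rw [sub_eq_iff_eq_add, add_comm, ← add_sub_assoc, eq_sub_iff_add_eq]; exact h'
    -- (u - u') + ... bookkeeping
  have hP : (u : L) - u' ∈ P := P.sub_mem (hAP u.2) (hAP u'.2)
  have hQ : (u : L) - u' ∈ Q := by rw [hd]; exact Q.sub_mem (hBQ v'.2) (hBQ v.2)
  have h0 : (u : L) - u' = 0 := by
    have hmem : (u : L) - u' ∈ P ⊓ Q := ⟨hP, hQ⟩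
    rw [hPQ.eq_bot] at hmem
    exact (AddSubgroup.mem_bot).mp hmem
  have hu : (u : L) = u' := sub_eq_zero.mp h0
  have hv : (v : L) = v' := by
    have : (v' : L) - v = 0 := by rw [← hd, h0]
    exact (sub_eq_zero.mp this).symm
  exact Prod.ext (Subtype.ext hu) (Subtype.ext hv)

/-- The image of a finite subgroup is finite. -/
theorem finite_map_of_finite {G L : Type*} [AddCommGroup G] [AddCommGroup L] (f : G →+ L)
    (S : AddSubgroup G) [Finite S] : Finite (S.map f) :=
  Finite.of_surjective (fun x : S => (⟨f x, AddSubgroup.mem_map_of_mem f x.2⟩ : S.map f))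
    (by
      rintro ⟨y, hy⟩
      obtain ⟨x, hx, rfl⟩ := AddSubgroup.mem_map.mp hy
      exact ⟨⟨x, hx⟩, rfl⟩)

/-- A subgroup of a finite subgroup is finite. -/
theorem finite_of_le' {G : Type*} [AddCommGroup G] {H K : AddSubgroup G} [Finite K] (h : H ≤ K) :
    Finite H :=
  Finite.of_injective (AddSubgroup.inclusion h) (AddSubgroup.inclusion_injective h)

/-! ### §2 The lozenge at ONE Kolyvagin prime `ℓ ∤ c` and ONE sign (pure group theory)

Dictionary ([J] §§4.3, 5.2, fixed level `p^m`, sign `s ∈ {+,−}`, `λ` the prime of `K` over `ℓ`):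
`loc ↦ loc_λ : H¹(K, E[p^m])^s → H¹(K_λ, E[p^m])^s`; `Rel ↦ 𝓗_{𝓕^ℓ(c)}^s` (no condition at `λ`);
`Hf ↦ H¹_f(K_λ, E[p^m])^s` (finite = unramified condition), `Htr ↦ H¹_tr(K_λ, E[p^m])^s` (transverse
condition), `Hf ⊓ Htr = 0`; hence `Rel ⊓ loc⁻¹(Hf) = 𝓗_{𝓕(c)}^s`, `Rel ⊓ loc⁻¹(Htr) = 𝓗_{𝓕(cℓ)}^s`,
`Rel ⊓ ker loc = 𝓗_{𝓕_ℓ(c)}^s`; the global-duality input is `#loc(Rel) = p^m` (= Lemma 5.2 (iii)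
`a + a^* = m` for the self-dual Kummer structure: `[𝓗_{𝓕^ℓ(c)} : 𝓗_{𝓕_ℓ(c)}] = p^m` per sign). -/

section OneStep

variable {G L : Type*} [AddCommGroup G] [AddCommGroup L]

/-- **ε-side of one step.** If a class `x ∈ 𝓗_{𝓕^ℓ(c)}` with `loc_λ x ∈ H¹_f` has `ord loc_λ x ≥
#loc_λ(𝓗_{𝓕^ℓ(c)})` (in the application: `x = κ̃_{c,m}` of order `p^m`, `ℓ` chosen by Lemma 6.1 so that
`ord loc_λ κ̃ = p^m`, and `#loc_λ(𝓗_{𝓕^ℓ(c)}) = p^m` by global duality), then the relaxed module already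
satisfies the finite condition at `λ` (`𝓗_{𝓕^ℓ(c)} = 𝓗_{𝓕(c)}`, lozenge length `a = 0`), the
transverse one collapses to the strict one (`𝓗_{𝓕(cℓ)} = 𝓗_{𝓕_ℓ(c)}`, `d = 0`), and
`#𝓗_{𝓕(c)} = #𝓗_{𝓕_ℓ(c)} · ord(loc_λ x)`. [cite: Jetchev2008, Lemma 5.2 and proof of Prop. 6.4 (pp. 821, 824)] -/
theorem lozenge_epsSide (loc : G →+ L) (Rel : AddSubgroup G) (Hf Htr : AddSubgroup L)
    (hdisj : Disjoint Hf Htr) [Finite (Rel.map loc)] {x : G} (hx : x ∈ Rel) (hxf : loc x ∈ Hf)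
    (hfull : Nat.card (Rel.map loc) ≤ addOrderOf (loc x)) :
    Rel ⊓ Hf.comap loc = Rel ∧ Rel ⊓ Htr.comap loc = Rel ⊓ loc.ker ∧
      Nat.card Rel = Nat.card ↥(Rel ⊓ loc.ker) * addOrderOf (loc x) := by
  -- the cyclic group generated by `loc x` exhausts `loc(Rel)`
  have hzle : AddSubgroup.zmultiples (loc x) ≤ Rel.map loc :=
    (AddSubgroup.zmultiples_le_of_mem (AddSubgroup.mem_map_of_mem loc hx))
  have heq : AddSubgroup.zmultiples (loc x) = Rel.map loc :=
    AddSubgroup.eq_of_le_of_card_ge hzle (by rw [Nat.card_zmultiples]; exact hfull)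
  -- hence `Rel ≤ loc⁻¹(Hf)`
  have hRel : Rel ≤ Hf.comap loc := by
    intro z hz
    have hz' : loc z ∈ AddSubgroup.zmultiples (loc x) := heq ▸ AddSubgroup.mem_map_of_mem loc hz
    obtain ⟨j, hj⟩ := AddSubgroup.mem_zmultiples_iff.mp hz'
    rw [AddSubgroup.mem_comap, ← hj]
    exact Hf.zsmul_mem hxf j
  refine ⟨inf_eq_left.mpr hRel, ?_, ?_⟩
  · ext z
    simp only [AddSubgroup.mem_inf, AddSubgroup.mem_comap, AddMonoidHom.mem_ker]
    constructor
    · rintro ⟨hz, hzt⟩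
      exact ⟨hz, (AddSubgroup.disjoint_def.mp hdisj) (hRel hz) hzt⟩
    · rintro ⟨hz, hz0⟩
      exact ⟨hz, by rw [hz0]; exact Htr.zero_mem⟩
  · rw [card_eq_card_inf_ker_mul_card_map loc Rel, ← heq, Nat.card_zmultiples]

/-- **−ε-side of one step.** For any class `y ∈ 𝓗_{𝓕(c)}` (finite condition at `λ`):
`#𝓗_{𝓕(cℓ)} · ord(loc_λ y)² ≤ #loc_λ(𝓗_{𝓕^ℓ(c)}) · #𝓗_{𝓕(c)}`. PROOF: with `S = 𝓗_{𝓕_ℓ(c)}` the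
common kernel, `#𝓗_{𝓕(c)} = #S · a`, `#𝓗_{𝓕(cℓ)} = #S · d` where `a = #loc(𝓗_{𝓕(c)}) ≥ ord loc y` and
`d = #loc(𝓗_{𝓕(cℓ)})`; the two images lie in the disjoint subgroups `H¹_f`, `H¹_tr` of `loc(𝓗_{𝓕^ℓ(c)})`,
so `a · d ≤ #loc(𝓗_{𝓕^ℓ(c)})` (Lemma 5.2 (ii)–(iv): `c + d ≤ a + c = m`). In the application
`#loc(𝓗_{𝓕^ℓ(c)}) = p^m` and `ord loc_λ y = ord y` (Lemma 6.1). [cite: Jetchev2008, Lemma 5.2 (pp. 821–822)] -/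
theorem lozenge_negSide (loc : G →+ L) (Rel : AddSubgroup G) (Hf Htr : AddSubgroup L)
    (hdisj : Disjoint Hf Htr) [Finite Rel] {y : G} (hy : y ∈ Rel) (hyf : loc y ∈ Hf) :
    Nat.card ↥(Rel ⊓ Htr.comap loc) * addOrderOf (loc y) ^ 2 ≤
      Nat.card (Rel.map loc) * Nat.card ↥(Rel ⊓ Hf.comap loc) := by
  set Y : AddSubgroup G := Rel ⊓ Hf.comap loc with hYdef
  set T : AddSubgroup G := Rel ⊓ Htr.comap loc with hTdef
  have hYR : Y ≤ Rel := inf_le_left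
  have hTR : T ≤ Rel := inf_le_left
  haveI : Finite Y := finite_of_le' hYR
  haveI : Finite T := finite_of_le' hTR
  haveI : Finite (Rel.map loc) := finite_map_of_finite loc Rel
  haveI : Finite (Y.map loc) := finite_map_of_finite loc Y
  -- common kernel
  have hYker : Y ⊓ loc.ker = Rel ⊓ loc.ker := by
    ext z
    simp only [hYdef, AddSubgroup.mem_inf, AddSubgroup.mem_comap, AddMonoidHom.mem_ker]
    constructor
    · rintro ⟨⟨hz, -⟩, hz0⟩; exact ⟨hz, hz0⟩
    · rintro ⟨hz, hz0⟩; exact ⟨⟨hz, by rw [hz0]; exact Hf.zero_mem⟩, hz0⟩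
  have hTker : T ⊓ loc.ker = Rel ⊓ loc.ker := by
    ext z
    simp only [hTdef, AddSubgroup.mem_inf, AddSubgroup.mem_comap, AddMonoidHom.mem_ker]
    constructor
    · rintro ⟨⟨hz, -⟩, hz0⟩; exact ⟨hz, hz0⟩
    · rintro ⟨hz, hz0⟩; exact ⟨⟨hz, by rw [hz0]; exact Htr.zero_mem⟩, hz0⟩
  have hY : Nat.card Y = Nat.card ↥(Rel ⊓ loc.ker) * Nat.card (Y.map loc) := by
    rw [← hYker]; exact card_eq_card_inf_ker_mul_card_map loc Y
  have hT : Nat.card T = Nat.card ↥(Rel ⊓ loc.ker) * Nat.card (T.map loc) := by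
    rw [← hTker]; exact card_eq_card_inf_ker_mul_card_map loc T
  -- the two images are disjoint inside `loc(Rel)`
  have hYP : Y.map loc ≤ Hf := by
    rintro _ ⟨z, hz, rfl⟩; exact hz.2
  have hTQ : T.map loc ≤ Htr := by
    rintro _ ⟨z, hz, rfl⟩; exact hz.2
  have had : Nat.card (Y.map loc) * Nat.card (T.map loc) ≤ Nat.card (Rel.map loc) :=
    card_map_mul_card_map_le loc hYR hTR hdisj hYP hTQ
  -- `ord loc y ≤ a`
  have hya : addOrderOf (loc y) ≤ Nat.card (Y.map loc) := by
    rw [← Nat.card_zmultiples]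
    exact AddSubgroup.card_le_of_le
      (AddSubgroup.zmultiples_le_of_mem (AddSubgroup.mem_map_of_mem loc (show y ∈ Y from ⟨hy, hyf⟩)))
  -- assemble
  calc Nat.card T * addOrderOf (loc y) ^ 2
      ≤ Nat.card T * Nat.card (Y.map loc) ^ 2 :=
        Nat.mul_le_mul_left _ (Nat.pow_le_pow_left hya 2)
    _ = Nat.card ↥(Rel ⊓ loc.ker) * Nat.card (Y.map loc) *
          (Nat.card (Y.map loc) * Nat.card (T.map loc)) := by rw [hT]; ring
    _ ≤ Nat.card ↥(Rel ⊓ loc.ker) * Nat.card (Y.map loc) * Nat.card (Rel.map loc) :=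
        Nat.mul_le_mul_left _ had
    _ = Nat.card (Rel.map loc) * Nat.card Y := by rw [hY]; ring

end OneStep

end Summit.BirchSwinnertonDyer.Rank1Residual.JET.Section6

end
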